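import Summits.CriticalPhenomena.SAWScalingLimit.Theorems.SAWLoopFugacityFlowIsingBoundaryRatioSideCrossSeparationHelpers
import HarnessLib

/-!
# Side-to-side crossings separate — lattice helpers
(line `fk-anchor-transfer`, crux `IsingBoundaryRatio`, stmt-CriticalPhenomena-10650; second of three modules proving
`AnnSideCrossSeparation`, see `…IsingBoundaryRatioSideCrossSeparation.lean`)

* `walkPath emb p` — the polyline of a walk drawn in the plane, as a `Path`; its points are the drawn start vertex or
  lie on the segment of a dart (`mem_range_walkPath`, `exists_dart_of_mem_range_walkPath`);
* `exists_common_endpoint` — two closed edges of `δℤ²` meet only at a common lattice endpoint (coordinates: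
  `re_im_bounds_of_mem_segment`, `eq_or_eq_of_mem_box`);
* `exists_not_isPerfect_of_mem_meshBoundary` — a boundary vertex of the mesh graph `Ω_δ` is a corner of a cell that
  is not perfect (`exists_corner_eq_of_adj`); `exists_connector` — hence (`Mesh.exists_accessPath`, first exit) it is
  joined to `∂D` by a path of diameter `< 6δ` inside `D` (except its foot), all of whose points other than the mesh
  point of the vertex avoid the mesh.

All statements are folklore lattice bookkeeping.
-/

noncomputable section

open scoped Classical Topology
open Filter Set Metric SimpleGraph Complex
open Literature.Probability.LatticeModels Literature.Probability.RandomPlanarGeometry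
open Literature.Probability.Percolation (BondConfig)
open Literature.Topology.PlaneTopology
open UpperHalfPlane (upperHalfPlaneSet)

namespace Summit.CriticalPhenomena.SAWScalingLimit.Theorems.IsingBoundaryRatio

/-! ### Polylines of lattice walks -/

/-- The polyline of a walk whose vertices are drawn in the plane by `emb`, as a path. [folklore] -/
def walkPath {V : Type*} (emb : V → ℂ) {G : SimpleGraph V} : {x y : V} → G.Walk x y → Path (emb x) (emb y)
  | _, _, Walk.nil => Path.refl _
  | _, _, Walk.cons (v := v) _ p => (Path.segment _ (emb v)).trans (walkPath emb p)

/-- A point of the polyline of a walk is the drawn start vertex or lies on the segment of a dart.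
[folklore] -/
theorem mem_range_walkPath {V : Type*} {emb : V → ℂ} {G : SimpleGraph V} :
    ∀ {x y : V} (p : G.Walk x y) {z : ℂ}, z ∈ range (walkPath emb p) →
      z = emb x ∨ ∃ d ∈ p.darts, z ∈ segment ℝ (emb d.fst) (emb d.snd)
  | _, _, Walk.nil, z, hz => by
    left
    simpa only [walkPath, Path.refl_range, mem_singleton_iff] using hz
  | _, _, Walk.cons h p, z, hz => by
    simp only [walkPath, Path.trans_range, Path.range_segment, mem_union] at hz
    right
    rcases hz with hz | hz
    · exact ⟨⟨(_, _), h⟩, by simp, hz⟩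
    · rcases mem_range_walkPath p hz with rfl | ⟨d, hd, hzd⟩
      · exact ⟨⟨(_, _), h⟩, by simp, right_mem_segment _ _ _⟩
      · exact ⟨d, by simp [hd], hzd⟩

/-- For a walk of positive length every point of the polyline lies on the segment of a dart.
[folklore] -/
theorem exists_dart_of_mem_range_walkPath {V : Type*} {emb : V → ℂ} {G : SimpleGraph V} {x y : V}
    (p : G.Walk x y) (hp : 0 < p.length) {z : ℂ} (hz : z ∈ range (walkPath emb p)) :
    ∃ d ∈ p.darts, z ∈ segment ℝ (emb d.fst) (emb d.snd) := by
  rcases mem_range_walkPath p hz with rfl | h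
  · cases p with
    | nil => simp at hp
    | cons h p => exact ⟨⟨(_, _), h⟩, by simp, left_mem_segment _ _ _⟩
  · exact h

/-- Coordinates of a point of the segment of a lattice edge. [folklore] -/
theorem re_im_bounds_of_mem_segment {δ : ℝ} (hδ : 0 < δ) {a b : Site 2} {z : ℂ}
    (hz : z ∈ segment ℝ (meshPoint δ a) (meshPoint δ b)) :
    δ * min (a 0 : ℝ) (b 0) ≤ z.re ∧ z.re ≤ δ * max (a 0 : ℝ) (b 0) ∧
      δ * min (a 1 : ℝ) (b 1) ≤ z.im ∧ z.im ≤ δ * max (a 1 : ℝ) (b 1) := by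
  rw [segment_eq_image'] at hz
  obtain ⟨t, ⟨ht0, ht1⟩, rfl⟩ := hz
  have ht1' : 0 ≤ 1 - t := sub_nonneg.2 ht1
  have key : ∀ (p q : ℝ), δ * p + t * (δ * q - δ * p) = δ * ((1 - t) * p + t * q) := fun p q => by ring
  have lo : ∀ (p q : ℝ), δ * min p q ≤ δ * p + t * (δ * q - δ * p) := fun p q => by
    rw [key]
    refine mul_le_mul_of_nonneg_left ?_ hδ.le
    nlinarith [mul_le_mul_of_nonneg_left (min_le_left p q) ht1', mul_le_mul_of_nonneg_left (min_le_right p q) ht0]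
  have hi : ∀ (p q : ℝ), δ * p + t * (δ * q - δ * p) ≤ δ * max p q := fun p q => by
    rw [key]
    refine mul_le_mul_of_nonneg_left ?_ hδ.le
    nlinarith [mul_le_mul_of_nonneg_left (le_max_left p q) ht1', mul_le_mul_of_nonneg_left (le_max_right p q) ht0]
  simp only [add_re, smul_re, sub_re, meshPoint_re, smul_eq_mul, add_im, smul_im, sub_im, meshPoint_im]
  exact ⟨lo _ _, hi _ _, lo _ _, hi _ _⟩

/-- A lattice point in the bounding box of a lattice edge is one of its endpoints. [folklore] -/
theorem eq_or_eq_of_mem_box {a b m : Site 2} (hab : (zdGraph 2).Adj a b)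
    (h0 : min (a 0) (b 0) ≤ m 0) (h0' : m 0 ≤ max (a 0) (b 0))
    (h1 : min (a 1) (b 1) ≤ m 1) (h1' : m 1 ≤ max (a 1) (b 1)) : m = a ∨ m = b := by
  rw [Literature.Probability.Percolation.zdGraph_two_adj_iff] at hab
  simp only [Site.eq_iff_two]
  omega

/-- **Two closed lattice edges meet only at a common endpoint.** [folklore] -/
theorem exists_common_endpoint {δ : ℝ} (hδ : 0 < δ) {a b a' b' : Site 2}
    (hab : (zdGraph 2).Adj a b) (hab' : (zdGraph 2).Adj a' b') {z : ℂ}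
    (hz : z ∈ segment ℝ (meshPoint δ a) (meshPoint δ b))
    (hz' : z ∈ segment ℝ (meshPoint δ a') (meshPoint δ b')) :
    ∃ m : Site 2, (m = a ∨ m = b) ∧ (m = a' ∨ m = b') := by
  obtain ⟨h0, h0', h1, h1'⟩ := re_im_bounds_of_mem_segment hδ hz
  obtain ⟨k0, k0', k1, k1'⟩ := re_im_bounds_of_mem_segment hδ hz'
  set m : Site 2 := ![max (min (a 0) (b 0)) (min (a' 0) (b' 0)), max (min (a 1) (b 1)) (min (a' 1) (b' 1))]
    with hm
  have c0 : min (a' 0 : ℝ) (b' 0 : ℝ) ≤ max (a 0 : ℝ) (b 0 : ℝ) := le_of_mul_le_mul_left (k0.trans h0') hδ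
  have c0' : min (a 0 : ℝ) (b 0 : ℝ) ≤ max (a' 0 : ℝ) (b' 0 : ℝ) := le_of_mul_le_mul_left (h0.trans k0') hδ
  have c1 : min (a' 1 : ℝ) (b' 1 : ℝ) ≤ max (a 1 : ℝ) (b 1 : ℝ) := le_of_mul_le_mul_left (k1.trans h1') hδ
  have c1' : min (a 1 : ℝ) (b 1 : ℝ) ≤ max (a' 1 : ℝ) (b' 1 : ℝ) := le_of_mul_le_mul_left (h1.trans k1') hδ
  have d0 : min (a' 0) (b' 0) ≤ max (a 0) (b 0) := by exact_mod_cast c0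
  have d0' : min (a 0) (b 0) ≤ max (a' 0) (b' 0) := by exact_mod_cast c0'
  have d1 : min (a' 1) (b' 1) ≤ max (a 1) (b 1) := by exact_mod_cast c1
  have d1' : min (a 1) (b 1) ≤ max (a' 1) (b' 1) := by exact_mod_cast c1'
  refine ⟨m, eq_or_eq_of_mem_box hab ?_ ?_ ?_ ?_, eq_or_eq_of_mem_box hab' ?_ ?_ ?_ ?_⟩ <;>
    simp only [hm, Matrix.cons_val_zero, Matrix.cons_val_one] <;> omega

/-! ### Access paths from boundary vertices of the mesh graph to `∂D` -/

/-- A lattice edge is a side of a cell: its endpoints are two corners of one cell. [folklore] -/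
theorem exists_corner_eq_of_adj {u y : Site 2} (h : (zdGraph 2).Adj u y) :
    ∃ (k j : ℤ) (a b a' b' : Bool), u = Mesh.corner k j a b ∧ y = Mesh.corner k j a' b' := by
  rw [Literature.Probability.Percolation.zdGraph_two_adj_iff] at h
  rcases h with ⟨h0, h1⟩ | ⟨h0, h1⟩ | ⟨h1, h0⟩ | ⟨h1, h0⟩
  · refine ⟨u 0, u 1, false, false, true, false, ?_, ?_⟩
    · simp [Site.eq_iff_two]
    · simp only [Site.eq_iff_two, Mesh.corner_zero, Mesh.corner_one]; simp; omega
  · refine ⟨y 0, u 1, true, false, false, false, ?_, ?_⟩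
    · simp only [Site.eq_iff_two, Mesh.corner_zero, Mesh.corner_one]; simp; omega
    · simp only [Site.eq_iff_two, Mesh.corner_zero, Mesh.corner_one]; simp; omega
  · refine ⟨u 0, u 1, false, false, false, true, ?_, ?_⟩
    · simp [Site.eq_iff_two]
    · simp only [Site.eq_iff_two, Mesh.corner_zero, Mesh.corner_one]; simp; omega
  · refine ⟨u 0, y 1, false, true, false, false, ?_, ?_⟩
    · simp only [Site.eq_iff_two, Mesh.corner_zero, Mesh.corner_one]; simp; omega
    · simp only [Site.eq_iff_two, Mesh.corner_zero, Mesh.corner_one]; simp; omega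

/-- A boundary vertex of `Ω_δ` is a corner of a cell that is not perfect. [folklore] -/
theorem exists_not_isPerfect_of_mem_meshBoundary {Ω : Set ℂ} {δ : ℝ} (hδ : 0 < δ) {u : Site 2}
    (hu : u ∈ meshBoundary Ω δ) :
    ∃ (k j : ℤ) (a b : Bool), u = Mesh.corner k j a b ∧ ¬ Mesh.IsPerfect Ω δ k j := by
  obtain ⟨huD, y, hy, hnadj⟩ := hu
  obtain ⟨k, j, a, b, a', b', rfl, rfl⟩ := exists_corner_eq_of_adj hy
  refine ⟨k, j, a, b, rfl, fun hp => hnadj ?_⟩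
  have hmg : (meshGraph Ω δ).Adj (Mesh.corner k j a b) (Mesh.corner k j a' b') :=
    meshGraph_adj_iff.2 ⟨hy, hp.1.segment_corner_subset hδ a b a' b'⟩
  have huv : Mesh.corner k j a b ∈ meshVertices Ω δ := hp.2 a b
  have hyv : Mesh.corner k j a' b' ∈ meshVertices Ω δ := hp.2 a' b'
  have hreach : (meshVertexGraph Ω δ).Reachable ⟨_, huv⟩ ⟨_, hyv⟩ :=
    SimpleGraph.Adj.reachable (by simpa using hmg)
  exact discreteDomainGraph_adj_iff.2
    ⟨hmg, huD, mem_meshDomain_of_reachable_meshVertexGraph huD huv hyv hreach⟩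

/-- **Connector.** From a boundary vertex `u` of the mesh graph of a Jordan domain there is a path to
a point of `∂D`, of diameter `< 6δ`, all of whose points other than the endpoint lie in `D` and all
of whose points other than the mesh point of `u` avoid the mesh. [folklore] -/
theorem exists_connector (D : JordanDomain) {δ : ℝ} (hδ : 0 < δ) {u : Site 2}
    (hu : u ∈ meshBoundary D.carrier δ) :
    ∃ (q : ℂ) (Q : Path (meshPoint δ u) q), q ∈ frontier D.carrier ∧
      (∀ t, Q t ∈ D.carrier ∨ Q t = q) ∧
      (∀ z ∈ range Q, dist z (meshPoint δ u) < 6 * δ) ∧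
      ∀ z ∈ range Q, z ≠ meshPoint δ u → Mesh.AvoidsMesh D.carrier δ z := by
  obtain ⟨k, j, a, b, huc, hnp⟩ := exists_not_isPerfect_of_mem_meshBoundary hδ hu
  obtain ⟨x, hxE, γ, hγA, hγd⟩ :=
    Mesh.exists_accessPath D.isOpen D.frontier_subset_closure_exterior' hδ hnp
  have hc := Mesh.cellCenter_mem_cell hδ k j
  have huD : meshPoint δ u ∈ D.carrier := meshDomain_subset_meshVertices _ _ hu.1
  have hxD : x ∉ D.carrier := fun h => hxE (subset_closure h)
  set full : Path (meshPoint δ u) x := (Path.segment (meshPoint δ u) (Mesh.cellCenter δ k j)).trans γ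
  obtain ⟨q, Q, hq, hQr, hQD⟩ := exists_firstExit full D.isOpen huD hxD
  have hfull : range full = segment ℝ (meshPoint δ u) (Mesh.cellCenter δ k j) ∪ range γ := by
    simp [full, Path.trans_range, Path.range_segment]
  have hdc : dist (Mesh.cellCenter δ k j) (meshPoint δ u) < 2 * δ := by
    rw [huc]; exact Mesh.dist_corner_lt_of_mem_cell hδ hc a b
  refine ⟨q, Q, hq, hQD, fun z hz => ?_, fun z hz hzu => ?_⟩
  · have hz' := hQr hz
    rw [hfull] at hz'
    rcases hz' with hz' | ⟨t, rfl⟩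
    · have : dist z (meshPoint δ u) ≤ dist (Mesh.cellCenter δ k j) (meshPoint δ u) :=
        (convex_closedBall _ _).segment_subset (mem_closedBall_self dist_nonneg) (mem_closedBall.2 le_rfl) hz'
      linarith
    · linarith [hγd t, dist_triangle (γ t) (Mesh.cellCenter δ k j) (meshPoint δ u)]
  · have hz' := hQr hz
    rw [hfull] at hz'
    rcases hz' with hz' | ⟨t, rfl⟩
    · rcases Mesh.eq_or_eq_or_mem_openSegment hz' with h | h | h
      · exact absurd h hzu
      · rw [h]; exact Mesh.avoidsMesh_of_mem_cell hδ hc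
      · refine Mesh.avoidsMesh_of_mem_cell hδ (Mesh.openSegment_corner_subset_cell hδ k j a b hc ?_)
        rwa [← huc]
    · exact hγA t


/-- A lattice edge is a side of some cell, closed form (registered sub-goal of stmt-CriticalPhenomena-10650). [folklore] -/
theorem exists_corner_eq_of_adj' : ∀ {u y : Site 2}, (zdGraph 2).Adj u y → ∃ (k j : ℤ) (a b a' b' : Bool), u = Mesh.corner k j a b ∧ y = Mesh.corner k j a' b' :=
  fun h => exists_corner_eq_of_adj h

end Summit.CriticalPhenomena.SAWScalingLimit.Theorems.IsingBoundaryRatio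

end
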